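/-
Copyright (c) 2026 the pub-hodgecm-mathlib formalisation cell (harness21).  Prover seat hodgecm-mathlib-R90-C131-p02 (g2) on the S4 valve (dealer K2E2-plan (g8), S4-R59 (4) ∕
S4-R63), road (J̃♭) FILE (TJ6) «HERBRAND WINDOW», part 2c of 3: THE DOUBLING INDEX THROUGH THE CAYLEY CHART, ITS FINITENESS, AND `θ`-TRANSPORT.
Crux H413 `stmt-HodgeConjecture-24833`, lane `--supports … --as helper` (count-neutral).  THEOREMS ONLY (no `def`, no `instance`, no notation, no named-fact hypothesis, no `sorry`).
-/
import Summits.HodgeConjecture.HodgeConjecture.Theorems.R90S4CayleyPsiNewton           -- (TJ6) part 2b (this seat): `exists_psi_eq`, `isCompact_eigen` (brings part 2a, ★ (C2), ★ (C4))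
import Summits.HodgeConjecture.HodgeConjecture.Theorems.R90S4HerbrandWindowIndex      -- (TJ6) part 1 (this seat): `relIndex_map_double_eq_of_relIndex_ne_zero`, `injective_double_of_forall_add_self`
import Mathlib.Topology.Algebra.OpenSubgroup                                          -- `AddSubgroup.quotient_finite_of_isOpen`
import Mathlib.GroupTheory.ArchimedeanDensely                                         -- `exists_pow_lt₀`
import HarnessLib

/-!
# R90-TF · S4 (Ch. 13.1–2) · road (J̃♭) «TWISTED TUBE JACOBIAN», FILE (TJ6) «HERBRAND WINDOW», part 2c: THE DOUBLING INDEX THROUGH THE CAYLEY CHART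

Cell `hodgecm-mathlib`, crux H413 (`stmt-HodgeConjecture-24833`, lane `--supports … --as helper`), route of record `HCCMUnconditional` (no route verbs;
count-neutral).  Programme R90-TF, section S4 = [Rogawski1990] Ch. 13.1–13.2 (twisted Weyl integration formula, §12.5 p. 186); seat R90-C131-p02 (g2);
ORDER = S4 dealer K2E2-plan (g8) S4-R59 (4) «(TJ6) HERBRAND WINDOW», spec S4-R63 (K2E3-p03 (g10)'s `h♮`).

SETTING.  `K` a field with a valuation (`ValuativeRel`; a non-archimedean local field where topology is used), `α < 1` the level ratio, `𝔞 ⊆ M_m(K)`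
a COMMUTATIVE `K`-subalgebra closed under inverses (at the datum: `𝔞 = Cent_{M₃(L_w)}(γ₀)`, `γ₀` regular), `E` an additive ANTI-involution of `M_m(K)`
(`E(XY) = E Y · E X`, `E 1 = 1`; at the datum `E X = Φ⁻¹ σ(X)ᵀ Φ`, the slot map of the twist `ε`), a parity `s` with `s·s = 1`, and the EIGEN-LATTICES
`M i = {X | X ≤ α^(i+1), X ∈ 𝔞, E X = s • X}` (a membership LETTER `hM`, no definition).  On the commutative `𝔞` the Cayley map `c(X) = (1 + X)(1 − X)⁻¹` turns
the group law into `c(W)·c(Z) = c(S(W, Z))`, `S(W, Z) = (W + Z)(1 + WZ)⁻¹` («velocity addition»), so squaring is `c(W)² = c(2ψ(W))`, `ψ(W) = W(1 + W²)⁻¹`.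

THE RESULTS (all PROVED).
* §4 `chart_injOn`, `chart_mul_chart` (for a group `G` with an injective matrix representation `ρG` and a chart `c` with `ρG (c X) = cayley X` on the ball
  `X ≤ α`: `c(W)·c(Z) = c(S(W, Z))`), `valBound_alpha_of_mem`; **`relIndex_sq_chart_eq_relIndex_double`** — if `H = c(M i)` and `H₂ = {h·h | h ∈ H}`
  (membership letters; subgroups of `G`) then **`[H : H₂] = [M i : 2·M i]`** (the chart identifies `H₂`-cosets with `⊕`-cosets of `2·M i` since
  `c(Y)² = c(2ψ Y)` and `ψ(M i) = M i` (part 2b), and these are the `+`-cosets by the COSET IDENTITIES of part 2a; `Quotient.congr`);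
  `relIndex_eigen_ne_zero` (`[M i : M (i+a)] ≠ 0`: open in compact), **`relIndex_double_ne_zero`** (`[M i : 2·M i] ≠ 0`: `2·M i ⊇ M (i+e)`, `αᵉ ≤ |2|`).
* §5 **`relIndex_double_eq_of_antiFixed`** — `θ`-TRANSPORT: an anti-fixed scalar (`E (θ•X) = −θ•E X`, `0 < |θ| ≤ 1`) gives `[M⁺ i : 2M⁺ i] = [M⁻ i : 2M⁻ i]`
  for the eigen-lattices of opposite parities (`θ•M⁺ i` is a finite-index subgroup of `M⁻ i`; doubling-index invariance, part 1).  This is «`dim 𝔨 = dim 𝔭`»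
  in index form, at every residue characteristic.

HONEST LABEL: HC_CM is proved only modulo the 7 printed citations (2 remaining named inputs: hLiu418 = `stmt-HodgeConjecture-24832`, h413 =
`stmt-HodgeConjecture-24833`) until rung 0 closes; this file closes no socket (REL ≠ ★ ≠ BUILT; count-neutral).

## References
* [Serre1992LALG] J.-P. Serre, *Lie Algebras and Lie Groups*, LNM 1500 (1992), Part II Ch. IV §8–§9 (standard groups, filtrations, the Cayley ∕ exponential charts). Context locator.
* [Serre1979] J.-P. Serre, *Local Fields*, GTM 67 (1979), VIII §4 (Herbrand quotient). Context locator.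
* [PlatonovRapinchuk1994] V. Platonov, A. Rapinchuk, *Algebraic Groups and Number Theory* (1994), §3.3 (congruence subgroups, Cayley map). Context locator.
* [Rogawski1990] J. D. Rogawski, *Automorphic Representations of Unitary Groups in Three Variables*, Ann. of Math. Stud. 123 (1990), §12.5 p. 186. Context locator.
-/

set_option autoImplicit false
-- the mandated namespace repeats the single-problem summit's segment (`HodgeConjecture.HodgeConjecture`)
set_option linter.dupNamespace false

open Set Filter TopologicalSpace Topology Matrix ValuativeRel
open Literature.NumberTheory.Automorphic Literature.NumberTheory.Weil1982.UnitaryFinTopForm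
open Summit.HodgeConjecture.HodgeConjecture.Cruxes.H413.F0P3cStCharTSFilteredNewton
open Summit.HodgeConjecture.HodgeConjecture.Cruxes.H413.F0P3cStCharTSCayleyChartHaar
open scoped Pointwise Topology MatrixGroups

namespace Summit.HodgeConjecture.HodgeConjecture.R90.S4

/-! ## §4 The doubling index through the chart: `[c(M i) : c(M i)²] = [M i : 2·M i]`, and `[M i : 2·M i] ≠ 0` -/

section Index

variable {K : Type*} [Field K] [ValuativeRel K] [TopologicalSpace K] [IsNonarchimedeanLocalField K] {m : Type*} [Fintype m] [DecidableEq m]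
  (𝔞 : Subalgebra K (Matrix m m K)) (h𝔞c : ∀ X ∈ 𝔞, ∀ Y ∈ 𝔞, X * Y = Y * X) (h𝔞i : ∀ X ∈ 𝔞, IsUnit X.det → X⁻¹ ∈ 𝔞)
  (h𝔞cl : IsClosed (𝔞 : Set (Matrix m m K)))
  (E : Matrix m m K →+ Matrix m m K) (hEm : ∀ X Y, E (X * Y) = E Y * E X) (hE1 : E 1 = 1) (hEc : Continuous E)
  {s : K} (hs : s * s = 1) {α : ValueGroupWithZero K} (hα : α ≠ 0) (hα1 : α < 1) (h2 : (2 : K) ≠ 0)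
  (M : ℕ → AddSubgroup (Matrix m m K)) (hM : ∀ i X, X ∈ M i ↔ (ValBound (α ^ (i + 1)) X ∧ X ∈ 𝔞 ∧ E X = s • X))
  (db : Matrix m m K →+ Matrix m m K) (hdb : ∀ X, db X = X + X)
  {G : Type*} [Group G] (ρG : G →* GL m K) (hρinj : Function.Injective ρG) (c : Matrix m m K → G)
  (hc : ∀ X, ValBound α X → ((ρG (c X) : GL m K) : Matrix m m K) = cayley X)

include hc hα1 h2 in
omit [TopologicalSpace K] [IsNonarchimedeanLocalField K] in
/-- The chart is injective on the ball (★ (C2) `eq_of_cayley_eq_cayley`, `ρG` injective). [cite: PlatonovRapinchuk1994, §3.3] -/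
theorem chart_injOn {X Y : Matrix m m K} (hX : ValBound α X) (hY : ValBound α Y) (h : c X = c Y) : X = Y :=
  eq_of_cayley_eq_cayley h2 hX hY hα1 (by rw [← hc X hX, ← hc Y hY, h])

include hρinj hc hα1 in
omit [TopologicalSpace K] [IsNonarchimedeanLocalField K] in
/-- **The chart is multiplicative for the velocity law on commuting small matrices**: `c(W)·c(Z) = c(S(W, Z))`. [cite: Serre1992LALG, Part II Ch. IV §8] -/
theorem chart_mul_chart {W Z : Matrix m m K} (hW : ValBound α W) (hZ : ValBound α Z) (hcomm : W * Z = Z * W) :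
    c W * c Z = c ((W + Z) * (1 + W * Z)⁻¹) := by
  apply hρinj
  apply Units.ext
  rw [map_mul, Units.val_mul, hc W hW, hc Z hZ, hc _ (by simpa using valBound_velocity_add hW hZ hα1 hα1.le),
    cayley_mul_cayley_of_comm hW hZ hα1 hα1 hcomm]

include hM hα1 in
omit [TopologicalSpace K] [IsNonarchimedeanLocalField K] in
/-- Level-`i` elements are in the ball `≤ α`. [cite: Serre1992LALG, Part II Ch. IV §9] -/
theorem valBound_alpha_of_mem {i : ℕ} {X : Matrix m m K} (hX : X ∈ M i) : ValBound α X :=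
  ((hM i X).1 hX).1.mono (by simpa using pow_le_pow_right_of_le_one' hα1.le (show 1 ≤ i + 1 by omega))

include h𝔞c h𝔞i h𝔞cl hEm hE1 hEc hs hα hα1 h2 hM hdb hρinj hc in
/-- **THE DOUBLING INDEX THROUGH THE CAYLEY CHART**: if `H = c(M i)` and `H₂ = {h·h | h ∈ H}` (membership letters; both subgroups of `G`), then
**`[H : H₂] = [M i : 2·M i]`** — the chart `c : (M i, ⊕) ≅ H` identifies the `H₂`-cosets with the `⊕`-cosets of `2·M i` (`c(Y)² = c(2ψ(Y))`, `ψ(M i) = M i`),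
and these coincide with the `+`-cosets (COSET IDENTITIES (1)(2)); `Quotient.congr` on the coset spaces. [cite: Serre1992LALG, Part II Ch. IV §8–§9] [cite: Serre1979, VIII §4] -/
theorem relIndex_sq_chart_eq_relIndex_double (i : ℕ) (H H₂ : Subgroup G) (hH : ∀ g, g ∈ H ↔ ∃ X ∈ M i, c X = g)
    (hH₂ : ∀ g, g ∈ H₂ ↔ ∃ h ∈ H, h * h = g) : H₂.relIndex H = ((M i).map db).relIndex (M i) := by
  classical
  have hb : ∀ {X}, X ∈ M i → ValBound α X := fun hX => valBound_alpha_of_mem 𝔞 E hα1 M hM hX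
  have hαi : α ^ (i + 1) < 1 := pow_lt_one₀ zero_le hα1 (Nat.succ_ne_zero i)
  -- the chart as an equivalence `M i ≃ H`
  have hmemH : ∀ X : ↥(M i), c X ∈ H := fun X => (hH _).2 ⟨X, X.2, rfl⟩
  let f : ↥(M i) → ↥H := fun X => ⟨c X, hmemH X⟩
  have hf : Function.Bijective f := by
    constructor
    · intro X Y hXY
      exact Subtype.ext (chart_injOn hα1 h2 ρG c hc (hb X.2) (hb Y.2) (congrArg Subtype.val hXY))
    · intro g
      obtain ⟨X, hX, hXg⟩ := (hH g).1 g.2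
      exact ⟨⟨X, hX⟩, Subtype.ext hXg⟩
  let e : ↥(M i) ≃ ↥H := Equiv.ofBijective f hf
  -- squares of chart points
  have hsq : ∀ {Y}, Y ∈ M i → c Y * c Y = c (Y * (1 + Y * Y)⁻¹ + Y * (1 + Y * Y)⁻¹) := by
    intro Y hY
    rw [chart_mul_chart hα1 ρG hρinj c hc (hb hY) (hb hY) rfl, add_mul]
  -- the relation transfer
  have key : ∀ X Y : ↥(M i), (-(X : Matrix m m K) + Y ∈ (M i).map db) ↔ ((c (X : Matrix m m K))⁻¹ * c (Y : Matrix m m K) ∈ H₂) := by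
    intro X Y
    have hX := X.2
    have hY := Y.2
    obtain ⟨-, hX𝔞, -⟩ := (hM i X).1 hX
    rw [AddSubgroup.mem_map, hH₂]
    simp only [eq_inv_mul_iff_mul_eq]
    constructor
    · rintro ⟨a, ha, hadb⟩
      rw [hdb] at hadb
      have hYeq : (Y : Matrix m m K) = X + (a + a) := by rw [hadb, add_neg_cancel_left]
      obtain ⟨-, ha𝔞, -⟩ := (hM i a).1 ha
      have ha'' := coset_corr_mem' 𝔞 h𝔞c h𝔞i E hEm hE1 hs M hM hα1 hX ha
      obtain ⟨Z, hZ, hZψ⟩ := exists_psi_eq 𝔞 h𝔞c h𝔞i h𝔞cl E hEm hE1 hEc hs hα hα1 M hM i ha''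
      have h2a := (M i).add_mem ha'' ha''
      refine ⟨c Z, (hH _).2 ⟨Z, hZ, rfl⟩, ?_⟩
      rw [hsq hZ, hZψ, chart_mul_chart hα1 ρG hρinj c hc (hb hX) (hb h2a) (h𝔞c _ hX𝔞 _ ((hM i _).1 h2a).2.1), hYeq,
        add_double_eq_velocity ((hM i X).1 hX).1 ((hM i a).1 ha).1 hαi (h𝔞c _ hX𝔞 _ ha𝔞)]
    · rintro ⟨h, hh, hhY⟩
      obtain ⟨Z, hZ, rfl⟩ := (hH h).1 hh
      have hψZ := psi_mem 𝔞 h𝔞c h𝔞i E hEm hE1 hs M hM hα1 hZ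
      obtain ⟨-, ha𝔞, -⟩ := (hM i _).1 hψZ
      have haa : Z * (1 + Z * Z)⁻¹ + Z * (1 + Z * Z)⁻¹ ∈ M i := (M i).add_mem hψZ hψZ
      rw [hsq hZ, chart_mul_chart hα1 ρG hρinj c hc (hb hX) (hb haa) (h𝔞c _ hX𝔞 _ ((hM i _).1 haa).2.1),
        velocity_add_double_eq ((hM i X).1 hX).1 ((hM i _).1 hψZ).1 hαi (h𝔞c _ hX𝔞 _ ha𝔞)] at hhY
      have ha' := coset_corr_mem 𝔞 h𝔞c h𝔞i E hEm hE1 hs M hM hα1 hX hψZ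
      have hsum := (M i).add_mem hX ((M i).add_mem ha' ha')
      have hYeq := chart_injOn hα1 h2 ρG c hc (hb hsum) (hb Y.2) hhY
      refine ⟨_, ha', ?_⟩
      rw [hdb, ← hYeq, neg_add_cancel_left]
  -- the coset spaces are in bijection
  have hcard : Nat.card (Quotient (QuotientAddGroup.leftRel (((M i).map db).addSubgroupOf (M i)))) =
      Nat.card (Quotient (QuotientGroup.leftRel (H₂.subgroupOf H))) := by
    refine Nat.card_congr (Quotient.congr e fun X Y => ?_)
    rw [QuotientAddGroup.leftRel_apply, QuotientGroup.leftRel_apply, AddSubgroup.mem_addSubgroupOf, Subgroup.mem_subgroupOf,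
      AddSubgroup.coe_add, AddSubgroup.coe_neg, Subgroup.coe_mul, Subgroup.coe_inv]
    exact key X Y
  unfold Subgroup.relIndex AddSubgroup.relIndex Subgroup.index AddSubgroup.index
  exact hcard.symm

include h𝔞cl hEc hM hα in
/-- **Deeper eigen-lattices have finite index**: `[M i : M (i + a)] ≠ 0` (`M (i+a)` is open in the compact group `M i`). [cite: Serre1992LALG, Part II Ch. IV §9]
[cite: PlatonovRapinchuk1994, §3.3] -/
theorem relIndex_eigen_ne_zero (i a : ℕ) : (M (i + a)).relIndex (M i) ≠ 0 := by
  haveI : CompactSpace ↥(M i) := isCompact_iff_compactSpace.1 (isCompact_eigen 𝔞 h𝔞cl E hEc M hM i)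
  have hopen : IsOpen (((M (i + a)).addSubgroupOf (M i) : AddSubgroup ↥(M i)) : Set ↥(M i)) := by
    have hset : (((M (i + a)).addSubgroupOf (M i) : AddSubgroup ↥(M i)) : Set ↥(M i)) =
        Subtype.val ⁻¹' {X : Matrix m m K | ValBound (α ^ (i + a + 1)) X} := by
      ext X
      simp only [AddSubgroup.coe_addSubgroupOf, Set.mem_preimage, Set.mem_setOf_eq, SetLike.mem_coe]
      rw [hM]
      exact ⟨fun h => h.1, fun h => ⟨h, ((hM i X).1 X.2).2⟩⟩
    rw [hset]
    exact (isOpen_setOf_valBound_matrix (pow_ne_zero _ hα)).preimage continuous_subtype_val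
  haveI := AddSubgroup.quotient_finite_of_isOpen _ hopen
  unfold AddSubgroup.relIndex
  exact AddSubgroup.index_ne_zero_of_finite

include hM hα1 h2 hdb in
/-- **Deep levels are doubles**: there is `e` (`αᵉ ≤ |2|`, `(2 : K) ≠ 0`) with `M (i + e) ≤ 2·M i` for every `i` — halving by `2⁻¹ ∈ K` keeps `𝔞` and, `E` being additive,
the parity. [cite: Serre1992LALG, Part II Ch. IV §9] [cite: PlatonovRapinchuk1994, §3.3] -/
theorem exists_eigen_le_map_double : ∃ e : ℕ, ∀ i, M (i + e) ≤ (M i).map db := by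
  have h2v : valuation K (2 : K) ≠ 0 := by rwa [Ne, map_eq_zero]
  obtain ⟨e, he⟩ := exists_pow_lt₀ hα1 (Units.mk0 _ h2v)
  have he' : α ^ e ≤ valuation K (2 : K) := by simpa using he.le
  refine ⟨e, fun i X hX => ?_⟩
  obtain ⟨hXb, hX𝔞, hEX⟩ := (hM _ X).1 hX
  set Y : Matrix m m K := (2 : K)⁻¹ • X with hYdef
  have hYY : Y + Y = X := by rw [hYdef, ← add_smul, ← two_mul, mul_inv_cancel₀ h2, one_smul]
  refine ⟨Y, (hM i Y).2 ⟨?_, 𝔞.smul_mem hX𝔞 _, ?_⟩, by rw [hdb, hYY]⟩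
  · intro p q
    rw [hYdef, Matrix.smul_apply, smul_eq_mul, map_mul, map_inv₀]
    have h2le : (valuation K (2 : K))⁻¹ * α ^ (i + e + 1) ≤ α ^ (i + 1) := by
      rw [show i + e + 1 = e + (i + 1) by omega, pow_add, ← mul_assoc]
      calc (valuation K (2 : K))⁻¹ * α ^ e * α ^ (i + 1) ≤ (valuation K (2 : K))⁻¹ * valuation K (2 : K) * α ^ (i + 1) :=
            mul_le_mul' (mul_le_mul' le_rfl he') le_rfl
        _ = α ^ (i + 1) := by rw [inv_mul_cancel₀ h2v, one_mul]
    exact (mul_le_mul' le_rfl (hXb p q)).trans h2le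
  · have hsum : E Y + E Y = s • Y + s • Y := by rw [← map_add, hYY, hEX, ← smul_add, hYY]
    have hd : (E Y - s • Y) + (E Y - s • Y) = 0 := by
      have h := sub_eq_zero.2 hsum
      calc (E Y - s • Y) + (E Y - s • Y) = E Y + E Y - (s • Y + s • Y) := by abel
        _ = 0 := h
    have h2d : (2 : K) • (E Y - s • Y) = 0 := by rw [two_smul, hd]
    rcases smul_eq_zero.1 h2d with h | h
    · exact absurd h h2
    · exact sub_eq_zero.1 h

include h𝔞cl hEc hM hα hα1 h2 hdb in
/-- **The doubling index of an eigen-lattice is finite**: `[M i : 2·M i] ≠ 0` — `2·M i ⊇ M (i + e)` (`exists_eigen_le_map_double`) and `[M i : M (i+e)] ≠ 0`.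
[cite: Serre1992LALG, Part II Ch. IV §9] [cite: PlatonovRapinchuk1994, §3.3] -/
theorem relIndex_double_ne_zero (i : ℕ) : ((M i).map db).relIndex (M i) ≠ 0 := by
  obtain ⟨e, he⟩ := exists_eigen_le_map_double 𝔞 E hα1 h2 M hM db hdb
  exact fun h0 => relIndex_eigen_ne_zero 𝔞 h𝔞cl E hEc hα M hM i e (AddSubgroup.relIndex_eq_zero_of_le_left (he i) h0)

end Index

/-! ## §5 `θ`-transport: the doubling indices of opposite eigen-lattices agree («`dim 𝔨 = dim 𝔭`», index form) -/

section Theta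

variable {K : Type*} [Field K] [ValuativeRel K] [TopologicalSpace K] [IsNonarchimedeanLocalField K] {m : Type*} [Fintype m] [DecidableEq m]
  (𝔞 : Subalgebra K (Matrix m m K)) (h𝔞cl : IsClosed (𝔞 : Set (Matrix m m K)))
  (E : Matrix m m K →+ Matrix m m K) (hEc : Continuous E)
  {s : K} {α : ValueGroupWithZero K} (hα : α ≠ 0) (hα1 : α < 1) (h2 : (2 : K) ≠ 0)
  (Mp Mn : ℕ → AddSubgroup (Matrix m m K))
  (hMp : ∀ i X, X ∈ Mp i ↔ (ValBound (α ^ (i + 1)) X ∧ X ∈ 𝔞 ∧ E X = s • X))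
  (hMn : ∀ i X, X ∈ Mn i ↔ (ValBound (α ^ (i + 1)) X ∧ X ∈ 𝔞 ∧ E X = (-s) • X))
  (db : Matrix m m K →+ Matrix m m K) (hdb : ∀ X, db X = X + X)
  {θ : K} (hθ0 : θ ≠ 0) (hθ1 : valuation K θ ≤ 1) (hEθ : ∀ X, E (θ • X) = -(θ • E X))

include h𝔞cl hEc hα hα1 h2 hMp hMn hdb hθ0 hθ1 hEθ in
/-- **`θ`-TRANSPORT: `[M⁺ i : 2·M⁺ i] = [M⁻ i : 2·M⁻ i]`** for the eigen-lattices of opposite parities `s`, `−s`.  An ANTI-FIXED scalar `θ` (`E (θ•X) = −θ•E X`,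
`0 < |θ| ≤ 1`; at the datum `θ̄ = −θ` in `L_w`) maps `M⁺ i` injectively onto `θ•M⁺ i`, a subgroup of `M⁻ i` containing `M⁻ (i + a)` (`αᵃ ≤ |θ|`), hence of
finite index; the doubling index is invariant under finite-index over-groups (part 1, `relIndex_map_double_eq_of_relIndex_ne_zero`) and under the isomorphism
`θ•`.  This is `dim 𝔨 = dim 𝔭` in index form, valid at every residue characteristic. [cite: Serre1979, VIII §4 Cor. to Prop. 8] [cite: Serre1992LALG, Part II Ch. IV §9] -/
theorem relIndex_double_eq_of_antiFixed (i : ℕ) : ((Mp i).map db).relIndex (Mp i) = ((Mn i).map db).relIndex (Mn i) := by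
  let f : Matrix m m K →+ Matrix m m K := DistribSMul.toAddMonoidHom (Matrix m m K) θ
  have hf : ∀ X, f X = θ • X := fun X => rfl
  have hfinj : Function.Injective f := smul_right_injective (Matrix m m K) hθ0
  have hθv : valuation K θ ≠ 0 := by rwa [Ne, map_eq_zero]
  -- `θ • M⁺ i ≤ M⁻ i`
  have hle : (Mp i).map f ≤ Mn i := by
    rintro _ ⟨X, hX, rfl⟩
    obtain ⟨hXb, hX𝔞, hEX⟩ := (hMp i X).1 hX
    refine (hMn i _).2 ⟨?_, 𝔞.smul_mem hX𝔞 θ, ?_⟩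
    · exact (valBound_smul θ hXb).mono (by simpa using mul_le_mul' hθ1 (le_refl (α ^ (i + 1))))
    · rw [hf, hEθ, hEX, smul_comm, ← neg_smul]
  -- `M⁻ (i + a) ≤ θ • M⁺ i` for `αᵃ ≤ |θ|`
  obtain ⟨a, ha⟩ := exists_pow_lt₀ hα1 (Units.mk0 _ hθv)
  have ha' : α ^ a ≤ valuation K θ := by simpa using ha.le
  have hge : Mn (i + a) ≤ (Mp i).map f := by
    intro X hX
    obtain ⟨hXb, hX𝔞, hEX⟩ := (hMn _ X).1 hX
    refine ⟨θ⁻¹ • X, (hMp i _).2 ⟨?_, 𝔞.smul_mem hX𝔞 _, ?_⟩, by rw [hf, smul_inv_smul₀ hθ0]⟩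
    · intro p q
      rw [Matrix.smul_apply, smul_eq_mul, map_mul, map_inv₀]
      calc (valuation K θ)⁻¹ * valuation K (X p q) ≤ (valuation K θ)⁻¹ * α ^ (i + a + 1) := mul_le_mul' le_rfl (hXb p q)
        _ ≤ α ^ (i + 1) := by
          rw [show i + a + 1 = a + (i + 1) by omega, pow_add, ← mul_assoc]
          calc (valuation K θ)⁻¹ * α ^ a * α ^ (i + 1) ≤ (valuation K θ)⁻¹ * valuation K θ * α ^ (i + 1) :=
                mul_le_mul' (mul_le_mul' le_rfl ha') le_rfl
            _ = α ^ (i + 1) := by rw [inv_mul_cancel₀ hθv, one_mul]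
    · have h := hEθ (θ⁻¹ • X)
      rw [smul_inv_smul₀ hθ0, hEX, neg_smul] at h
      have h1 : s • X = θ • E (θ⁻¹ • X) := neg_inj.1 h
      calc E (θ⁻¹ • X) = θ⁻¹ • (θ • E (θ⁻¹ • X)) := (inv_smul_smul₀ hθ0 _).symm
        _ = θ⁻¹ • (s • X) := by rw [← h1]
        _ = s • (θ⁻¹ • X) := smul_comm _ _ _
  -- finite index, then part 1
  have hfin : ((Mp i).map f).relIndex (Mn i) ≠ 0 := fun h0 =>
    relIndex_eigen_ne_zero 𝔞 h𝔞cl E hEc hα Mn hMn i a (AddSubgroup.relIndex_eq_zero_of_le_left hge h0)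
  have hdbinj : Function.Injective db :=
    injective_double_of_forall_add_self db hdb fun x hx => by
      rw [← two_smul K] at hx
      exact (smul_eq_zero.1 hx).resolve_left h2
  have hinv := relIndex_map_double_eq_of_relIndex_ne_zero db hdb hdbinj hle hfin
  rw [← hinv]
  have hcomm : ((Mp i).map f).map db = ((Mp i).map db).map f := by
    rw [AddSubgroup.map_map, AddSubgroup.map_map]
    congr 1
    refine AddMonoidHom.ext fun X => ?_
    rw [AddMonoidHom.comp_apply, AddMonoidHom.comp_apply, hf, hf, hdb, hdb, smul_add]
  rw [hcomm, AddSubgroup.relIndex_map_map_of_injective _ _ hfinj]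

end Theta

end Summit.HodgeConjecture.HodgeConjecture.R90.S4
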